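import Summits.BirchSwinnertonDyer.BirchSwinnertonDyer.Theorems.QuadraticBranchSignedControlPlusKatoDivisibilityOfKatoColeman
import HarnessLib

/-!
# Route `QuadraticBranchSignedControl` (rung K8, cell `bsd-potss`), item `PlusKatoDivisibilityBranch`
# (stmt-BirchSwinnertonDyer-19241): the item FROM the signed-Coleman-map package and Kobayashi's
# Thm. 1.2 ALONE — Thm. 4.1 at `η` (19612) AND Thm. 2.2 at `η` (19613) both DERIVED

WHAT. The sibling file `…PlusKatoDivisibilityOfKatoColeman.lean` (seat `bsd-potss-k8q-c2x`, lane B of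
19241) derives from the ONE package fact `Kobayashi2003.thm52_62_63_73_etaKatoColemanPoitouTate`
(Kobayashi Thm. 5.2 iii)–v) + 6.2 + 6.3 + 7.3 i) + Cor. 7.2 at `η` on pinned objects): §2 Thm. 4.1 at
`η` (`thm41_plusEtaCharIdeal_dvd`, item 19612) and §3 both clauses of Thm. 2.2 at `η ≠ 1` on the newform
frame. The named fact `thm22_etaSignedSelmerDual_finite_torsion` (item 19613) has a WIDER frame (no
newform, `η = 1` allowed), so it is not a consequence as stated; but lane A's decomposition argument
(`quadraticBranchPlusKatoDivisibilityAt_of_namedFacts_of_decomposition`, p422507) consumes Thm. 2.2 at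
`η` ONLY on the newform frame at the non-trivial `η` and the sign `+` — exactly where §3 applies. THIS
FILE re-runs that argument with `h41` and `h22` replaced by the package: (RK⁺)
`QuadraticBranchPlusKatoDivisibilityAt V p` at every pair, and the route decl `PlusKatoDivisibilityBranch`,
from the package fact + Thm. 1.2 (`thm12_signedSelmerDual_finite_torsion`, item 19286, for the
`ℚ_∞`-datum) with the frame the tree THEOREM `etaDescentFrame_proof`. So 19241's trust base is
{§5–7 package at `η`, Thm. 1.2}.

HONEST FRAMING (cell `bsd-potss`, run/shared/lean/pub/bsd-potss/; FULL-BSD rank ≤ 1 programme): TOOL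
THEOREMS ONLY — no definition, no named fact minted here, no `sorry`, axioms standard. CONDITIONAL on
the package fact (Kato's Euler system and explicit reciprocity law, Kobayashi's Coleman maps,
Poitou–Tate along the tower — deep, not in Mathlib) and on Thm. 1.2; the item is NOT closed by this
(it stays settled-by-citation); nothing is booked; `BSD(W, p)` is claimed for no pair; this is not
"finishing BSD". Seat `bsd-potss-k8q-c2x` (prover), g0; `--supports stmt-BirchSwinnertonDyer-19241`.

References: [Kobayashi2003] Thm. 1.2 (p. 2), Thm. 2.2 (p. 5), Thm. 4.1 (p. 8), Thm. 5.2 (p. 9), §7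
(pp. 11–13); [Kato2004Asterisque] Thm. 12.5; [GreenbergLNM1716] §1 (p. 60), §3; [Washington1997] §13.2.
-/

set_option autoImplicit false
-- justification: the `Summit.BirchSwinnertonDyer.BirchSwinnertonDyer.…` path repeats a component (route-file convention)
set_option linter.dupNamespace false

noncomputable section

open scoped Classical

open CongruenceSubgroup Field WeierstrassCurve
open Literature.NumberTheory.EllipticCurves
open Literature.NumberTheory.EllipticCurves.ModularForms
open Literature.NumberTheory.GaloisRepresentations
open Summit.BirchSwinnertonDyer.Rank1Residual.Additive hiding EtaSignedSelmerDualData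
  IsQuadraticBranchPlusLFunction IsQuadraticBranchMinusLFunction
open Summit.BirchSwinnertonDyer.Rank1Residual.Additive.SignedTwist
open Summit.BirchSwinnertonDyer.BirchSwinnertonDyer.Theses.QuadraticBranchSignedControl

namespace Summit.BirchSwinnertonDyer.BirchSwinnertonDyer.Theorems

/-- **(RK⁺) AT A PAIR from the package fact, Thm. 1.2 and the frame** (abstract cyclotomic model `K₀`,
character `ηq` trivial on `Gal(ℚ̄/K₀)` and non-trivial): `hK` = the package fact
`Kobayashi2003.thm52_62_63_73_etaKatoColemanPoitouTate`, `h12` = `thm12_signedSelmerDual_finite_torsion`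
(Thm. 1.2), both in hypothesis position; `hdec` = the ∀-form descent frame at `(V, p, K₀, ηq)` (a tree
theorem on Gss2 rows, displayed here as in lane A's p422507). Conclusion:
`QuadraticBranchPlusKatoDivisibilityAt V p`. Proof = lane A's decomposition argument VERBATIM
(`exists_etaDatum_prod_linearEquiv_of_decomposition`: `DF.X ≃ D.X × Dη.X`; `Char DF = Char D · Char Dη`
by multiplicativity) with Thm. 2.2 at `η` for `Dη` supplied by the sibling's §3
(`finite_isTorsion_etaSignedSelmerDual_of_etaKatoColemanPoitouTate`) and Thm. 4.1 at `η` for `Dη` by its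
§2 (`thm41_plusEtaCharIdeal_dvd_of_etaKatoColemanPoitouTate`). CONDITIONAL; closes nothing.
[cite: Kobayashi2003, Thm. 1.2 (p. 2), Thm. 2.2 (p. 5), Thm. 4.1 (p. 8), last sentence of §7 (p. 13)]
[cite: Washington1997, §13.2 (characteristic ideals over Λ)] -/
theorem quadraticBranchPlusKatoDivisibilityAt_of_etaKatoColemanPoitouTate_of_thm12_of_decomposition
    {V : WeierstrassCurve ℚ} [V.IsElliptic] [V.IsGloballyMinimal] {p : ℕ} [Fact p.Prime]
    (hK : Kobayashi2003.thm52_62_63_73_etaKatoColemanPoitouTate)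
    (h12 : Kobayashi2003.thm12_signedSelmerDual_finite_torsion)
    (K₀ : Type) [Field K₀] [NumberField K₀] [IsCyclotomicExtension {p} ℚ K₀]
    [(galRange (K := ℚ) K₀).Normal] (ηq : absoluteGaloisGroup ℚ →* ℤˣ)
    (hηK : ∀ σ ∈ galRange (K := ℚ) K₀, ηq σ = 1) (hη1 : ηq ≠ 1)
    (hdec : ∀ (κ : ZpExtension ℚ p) (γ : absoluteGaloisGroup ℚ),
        κ.IsCyclotomic → κ.IsTopGenerator γ → γ ∈ galRange (K := ℚ) K₀ →
        IsCyclotomicVariable p γ →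
      ∀ (F : Type) [Field F] [NumberField F] (V' : WeierstrassCurve F) [V'.IsElliptic]
        (κF : ZpExtension F p) (γF : absoluteGaloisGroup F),
        Module.finrank ℚ F = 2 → (∃ θ : F, θ ^ 2 = algebraMap ℚ F ((-1) ^ (p / 2) * p)) →
        (∃ C : VariableChange F, C • V.baseChange F = V') →
        κF.IsCyclotomic → κF.IsTopGenerator γF →
        (∃ ζ : ℤ_[p]ˣ, IsOfFinOrder ζ ∧
          ((GaloisRep.cyclotomicCharacter F p γF * ζ : ℤ_[p]ˣ) : ℤ_[p]) =
            (cyclotomicGenerator p : ℤ_[p])) →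
      ∃ Φ : Kobayashi2003.signedSelmerInfty V' κF 1 ≃+
          Kobayashi2003.signedSelmerInfty V κ 1 × towerSignedSelmerInftyEta V κ K₀ ℚ_[p] ηq 1,
        ∀ s : Kobayashi2003.signedSelmerInfty V' κF 1,
          ((Φ ⟨V'.conjH1 p κF.kerSubgroup γF s,
              Kobayashi2003.conjH1_mem_signedSelmerInfty V' κF 1 γF s.2⟩).1 :
              V.subgroupH1 p κ.kerSubgroup) =
            V.conjH1 p κ.kerSubgroup γ (Φ s).1 ∧
          ((Φ ⟨V'.conjH1 p κF.kerSubgroup γF s,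
              Kobayashi2003.conjH1_mem_signedSelmerInfty V' κF 1 γF s.2⟩).2 :
              V.subgroupH1 p (towerTopSubgroup κ K₀)) =
            V.conjH1 p (towerTopSubgroup κ K₀) γ (Φ s).2) :
    QuadraticBranchPlusKatoDivisibilityAt V p := by
  intro F _ _ V' _ κ γ κF γF N _ f hp2 hgood hap hF hθ hC hκ hγ hγc hκF hγF hζ hf ϖ hϖ Lη hL D DF
  obtain ⟨γ', hγ'K, hγ', hγ'c, Dη, ⟨e⟩⟩ :=
    exists_etaDatum_prod_linearEquiv_of_decomposition K₀ ηq hdec F V' hF hθ hC hκ hγ hγc hκF hγF hζ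
      D DF
  -- Thm. 1.2 for `D`
  obtain ⟨hDfin, hDtor⟩ := h12 V p hp2 hgood hap κ γ hκ hγ 1 D
  -- Thm. 2.2 and Thm. 4.1 at `η` for `Dη`, DERIVED from the package, through the Literature promotion
  -- copy of the `η`-object
  let Dη' : Kobayashi2003.EtaSignedSelmerDualData V κ K₀ ℚ_[p] ηq γ' 1 :=
    { X := Dη.X
      conj_mem := Dη.conj_mem
      toDual := Dη.toDual
      bijective := Dη.bijective
      toDual_T_smul := Dη.toDual_T_smul
      toDual_C_smul := Dη.toDual_C_smul }
  obtain ⟨hηfin, hηtor⟩ :=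
    (finite_isTorsion_etaSignedSelmerDual_of_etaKatoColemanPoitouTate hK p K₀ ηq hηK hη1 V hp2 hgood
      hap hf ϖ hϖ κ γ' hκ hγ' hγ'K hγ'c).1 Dη'
  obtain ⟨⟨n, hn⟩, hint⟩ :=
    thm41_plusEtaCharIdeal_dvd_of_etaKatoColemanPoitouTate hK p K₀ ηq hηK hη1 V hp2 hgood hap hf ϖ hϖ
      Lη hL κ γ' hκ hγ' hγ'K hγ'c Dη' hηfin hηtor
  -- the product is finitely generated torsion with `Char = Char D.X · Char Dη.X`
  haveI : Module.Finite (IwasawaAlgebra p) D.X := hDfin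
  haveI : Module.Finite (IwasawaAlgebra p) Dη.X := hηfin
  haveI hPfin : Module.Finite (IwasawaAlgebra p) (D.X × Dη.X) := inferInstance
  have hPtor : Module.IsTorsion (IwasawaAlgebra p) (D.X × Dη.X) :=
    isTorsion_prod_of_isTorsion hDtor hηtor
  have hPchar : Module.charIdeal (IwasawaAlgebra p) (D.X × Dη.X) =
      Module.charIdeal (IwasawaAlgebra p) D.X * Module.charIdeal (IwasawaAlgebra p) Dη.X :=
    charIdeal_mul_of_shortExact_holds p (D.X × Dη.X) hPtor
      (LinearMap.inl (IwasawaAlgebra p) D.X Dη.X) (LinearMap.snd (IwasawaAlgebra p) D.X Dη.X)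
      LinearMap.inl_injective LinearMap.snd_surjective .inl_snd
  -- transport to `DF`
  have hfinF : Module.Finite (IwasawaAlgebra p) DF.X := Module.Finite.equiv e.symm
  have htorF : Module.IsTorsion (IwasawaAlgebra p) DF.X := by
    intro x
    obtain ⟨a, ha⟩ := @hPtor (e x)
    refine ⟨a, ?_⟩
    rw [Submonoid.smul_def] at ha ⊢
    have h := congrArg e.symm ha
    rwa [map_smul, map_zero, LinearEquiv.symm_apply_apply] at h
  have hcharF : DF.charIdeal = D.charIdeal * Dη.charIdeal := by
    change Module.charIdeal (IwasawaAlgebra p) DF.X =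
      Module.charIdeal (IwasawaAlgebra p) D.X * Module.charIdeal (IwasawaAlgebra p) Dη.X
    rw [Module.charIdeal_eq_of_linearEquiv e]
    exact hPchar
  refine ⟨hfinF, htorF, ⟨n, ?_⟩, fun hsurj => ?_⟩
  · rw [hcharF, mul_left_comm, Ideal.span_singleton_mul_span_singleton]
    exact Ideal.mul_mono_right ((Ideal.span_singleton_le_iff_mem _).mpr hn)
  · rw [hcharF]
    exact Ideal.mul_mono_right ((Ideal.span_singleton_le_iff_mem _).mpr (hint hsurj))

/-- **Item 19241 `PlusKatoDivisibilityBranch` FROM the package fact and Kobayashi's Thm. 1.2 ALONE**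
(route-level; the conclusion is the route decl literally): `K₀ := ℚ(ζ_p)`, `ηq` the quadratic
character from `exists_theta_eta_cyclotomicField`, the frame the tree THEOREM `etaDescentFrame_proof`
(item 19611, closed), and the previous theorem. Hypotheses: `hK` — the package fact
`Kobayashi2003.thm52_62_63_73_etaKatoColemanPoitouTate` (Thm. 5.2 iii)–v) + 6.2 + 6.3 + 7.3 i) + Cor. 7.2
at `η`, on pinned objects); `h12` — `thm12_signedSelmerDual_finite_torsion` (Thm. 1.2). The held cites
19612 (Thm. 4.1 at `η`) and 19613 (Thm. 2.2 at `η`) of lane A's road are NOT hypotheses here: both are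
derived from `hK` on the frames the proof visits. So 19241's trust base = {the §5–7 package at `η`,
Thm. 1.2}. CONDITIONAL on those two named facts; the item stays settled-by-citation; closes nothing.
[cite: Kobayashi2003, Thm. 1.2 (p. 2), Thm. 5.2 iii)–v) (p. 9), Thm. 6.2, 6.3 (p. 11), Thm. 7.3 i), Cor. 7.2, proof of Thm. 7.4 and last sentence of §7 (p. 13)]
[cite: Kato2004Asterisque, Thm. 12.5 (pp. 221–222)]
[cite: GreenbergLNM1716, §1 (p. 60) and §3 (descent in prime-to-p extensions; reading)] -/
theorem plusKatoDivisibilityBranch_of_etaKatoColemanPoitouTate_of_thm12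
    (hK : Kobayashi2003.thm52_62_63_73_etaKatoColemanPoitouTate)
    (h12 : Kobayashi2003.thm12_signedSelmerDual_finite_torsion) :
    PlusKatoDivisibilityBranch := by
  intro V _ _ p _ hp5 hgood hap
  have hp2 : p ≠ 2 := by omega
  haveI : NeZero p := ⟨(Fact.out : p.Prime).ne_zero⟩
  haveI : IsCyclotomicExtension {p} ℚ (CyclotomicField p ℚ) :=
    CyclotomicField.isCyclotomicExtension p ℚ
  haveI : (galRange (K := ℚ) (CyclotomicField p ℚ)).Normal := normal_galRange_cyclotomic p _
  obtain ⟨θ, ηq, -, -, -, hηK, hη1⟩ := exists_theta_eta_cyclotomicField p hp2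
  exact quadraticBranchPlusKatoDivisibilityAt_of_etaKatoColemanPoitouTate_of_thm12_of_decomposition hK
    h12 (CyclotomicField p ℚ) ηq hηK hη1
    (fun κ γ hκ hγ hγK hγc F _ _ V' _ κF γF hF hθ hC hκF hγF hζ =>
      etaDescentFrame_proof p hp5 (CyclotomicField p ℚ) ηq hηK hη1 V hgood hap κ γ hκ hγ hγK hγc F V'
        κF γF hF hθ hC hκF hγF hζ)

end Summit.BirchSwinnertonDyer.BirchSwinnertonDyer.Theorems

end
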